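import Summits.QuantumAdvantage.QuantumAdvantage.Theorems.RigidityLawsA

/-! # RigidityLawsB — part 2/3 (mechanical split for landing of `RigidityLaws`; content verbatim; scopes re-opened with their variables) -/


namespace Summit.QuantumAdvantage.AdviceFreeQNC0.RigidityLaws
open Classical
open Finset
open Summit.QuantumAdvantage.AdviceFreeQNC0
open Literature.Computability.MetaComplexity Literature.Computability.MetaComplexity.Smolensky
variable {n : ℕ}

/-- `{0}` is RIGID at `k` exactly on `{u : k + wt u ≡ 0}` (a third of the cube). -/
theorem rigid_blindZero_iff (k : ℕ) (u : Fin n → Bool) :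
    (ringWinU (k + 1) (blind ({0} : Finset (Fin (n + 1)))) u = true ∧
        ringWinU (k + 2) (blind ({0} : Finset (Fin (n + 1)))) u = true) ↔ (k + wt u) % 3 = 0 := by
  rw [ringWinU_blindZero, ringWinU_blindZero]
  omega

/-- `{0, n}` is RIGID at `k ≡ n` exactly on `{u : n + wt u ≢ 0}` (two thirds of the cube). -/
theorem rigid_blindEnds_iff (hn : 1 ≤ n) (k : ℕ) (hk : k % 3 = n % 3) (u : Fin n → Bool) :
    (ringWinU (k + 1) (blind ({0, Fin.last n} : Finset (Fin (n + 1)))) u = true ∧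
        ringWinU (k + 2) (blind ({0, Fin.last n} : Finset (Fin (n + 1)))) u = true) ↔
      (n + wt u) % 3 ≠ 0 := by
  rw [ringWinU_blindEnds hn, ringWinU_blindEnds hn]
  have h3 : (n + wt u) % 3 = 0 ∨ (n + wt u) % 3 = 1 ∨ (n + wt u) % 3 = 2 := by omega
  rcases h3 with h | h | h
  · constructor
    · rintro ⟨h1, -⟩
      rcases h1 with ⟨h1a, h1b⟩ | ⟨h1a, h1b⟩ <;> omega
    · intro h'
      exact absurd h h'
  · constructor
    · intro _
      omega
    · intro _
      exact ⟨Or.inl ⟨by omega, by omega⟩, Or.inr ⟨by omega, by omega⟩⟩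
  · constructor
    · intro _
      omega
    · intro _
      exact ⟨Or.inr ⟨by omega, by omega⟩, Or.inl ⟨by omega, by omega⟩⟩

/-- equidistribution of the weight mod 3 (from the landed `three_mul_card_affine_mod_three`):
`|3·#{u : c + wt u ≡ r} − 2ⁿ| ≤ 2`. -/
theorem three_mul_card_wt_mod (n c r : ℕ) (hr : r < 3) :
    (2 : ℤ) ^ n - 2 ≤ 3 * ((univ.filter fun u : Fin n → Bool => (c + wt u) % 3 = r).card : ℤ) ∧
      3 * ((univ.filter fun u : Fin n → Bool => (c + wt u) % 3 = r).card : ℤ) ≤ (2 : ℤ) ^ n + 2 := by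
  have h := three_mul_card_affine_mod_three n (fun _ => 1) (fun _ => by norm_num) c r
  have hset : (univ.filter fun u : Fin n → Bool =>
      (c + ∑ i, (if u i = true then (fun _ : Fin n => (1 : ℕ)) i else 0)) % 3 = r % 3) =
        univ.filter fun u : Fin n → Bool => (c + wt u) % 3 = r := by
    apply Finset.filter_congr
    intro u _
    rw [Nat.mod_eq_of_lt hr, wt, Finset.card_filter]
  unfold affCount at h
  rw [hset] at h
  exact h

/-- real-valued form of the weight-class count bounds `|3·#{wt ≡ r − c} − 2ⁿ| ≤ 2`. -/
theorem card_wt_mod_bounds (n c r : ℕ) (hr : r < 3) :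
    (2 : ℝ) ^ n / 3 - 2 / 3 ≤ ((univ.filter fun u : Fin n → Bool => (c + wt u) % 3 = r).card : ℝ) ∧
      ((univ.filter fun u : Fin n → Bool => (c + wt u) % 3 = r).card : ℝ) ≤ (2 : ℝ) ^ n / 3 + 2 / 3 := by
  obtain ⟨h1, h2⟩ := three_mul_card_wt_mod n c r hr
  have h1' : (2 : ℝ) ^ n - 2 ≤ 3 * ((univ.filter fun u : Fin n → Bool => (c + wt u) % 3 = r).card : ℝ) := by
    exact_mod_cast h1
  have h2' : 3 * ((univ.filter fun u : Fin n → Bool => (c + wt u) % 3 = r).card : ℝ) ≤ (2 : ℝ) ^ n + 2 := by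
    exact_mod_cast h2
  constructor <;> linarith

/-- the inputs with `(c + wt u) % 3 ≠ 0` number at least `(2/3)·2ⁿ − 2/3`. -/
theorem card_wt_mod_ne_zero (n c : ℕ) :
    ((univ.filter fun u : Fin n → Bool => (c + wt u) % 3 ≠ 0).card : ℝ) =
      (2 : ℝ) ^ n - ((univ.filter fun u : Fin n → Bool => (c + wt u) % 3 = 0).card : ℝ) := by
  have h := Finset.card_filter_add_card_filter_not
    (s := (univ : Finset (Fin n → Bool))) (fun u : Fin n → Bool => (c + wt u) % 3 = 0)
  simp only [card_univ, Fintype.card_fun, Fintype.card_bool, Fintype.card_fin] at h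
  have h' : ((univ.filter fun u : Fin n → Bool => (c + wt u) % 3 = 0).card : ℝ) +
      ((univ.filter fun u : Fin n → Bool => (c + wt u) % 3 ≠ 0).card : ℝ) = (2 : ℝ) ^ n := by
    exact_mod_cast h
  linarith

/-- corner `(1/3, ·)`: the one-shot strategy is rigid on a third of the cube (± 2/3). -/
theorem rigid_corner_third (k : ℕ) :
    (2 : ℝ) ^ n / 3 - 2 / 3 ≤ ((univ.filter fun u : Fin n → Bool =>
        ringWinU (k + 1) (blind ({0} : Finset (Fin (n + 1)))) u = true ∧
          ringWinU (k + 2) (blind ({0} : Finset (Fin (n + 1)))) u = true).card : ℝ) ∧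
      ((univ.filter fun u : Fin n → Bool =>
        ringWinU (k + 1) (blind ({0} : Finset (Fin (n + 1)))) u = true ∧
          ringWinU (k + 2) (blind ({0} : Finset (Fin (n + 1)))) u = true).card : ℝ) ≤ (2 : ℝ) ^ n / 3 + 2 / 3 := by
  rw [Finset.filter_congr fun u _ => rigid_blindZero_iff (n := n) k u]
  exact card_wt_mod_bounds n k 0 (by norm_num)

/-- corner `(2/3, 0)`: the two-shot strategy `{0, n}` is rigid (at `k ≡ n`) on two thirds of the cube. -/
theorem rigid_corner_twoThirds (hn : 1 ≤ n) (k : ℕ) (hk : k % 3 = n % 3) :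
    (2 / 3 : ℝ) * (2 : ℝ) ^ n - 2 / 3 ≤ ((univ.filter fun u : Fin n → Bool =>
        ringWinU (k + 1) (blind ({0, Fin.last n} : Finset (Fin (n + 1)))) u = true ∧
          ringWinU (k + 2) (blind ({0, Fin.last n} : Finset (Fin (n + 1)))) u = true).card : ℝ) := by
  rw [Finset.filter_congr fun u _ => rigid_blindEnds_iff (n := n) hn k hk u, card_wt_mod_ne_zero]
  have h := (card_wt_mod_bounds n n 0 (by norm_num)).2
  linarith


/-- **No rigidity constant below 2/3** (even at `C = 0`, i.e. against degree-1 strategies; the witness has degree 0).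
In particular the cheap lift "rigidity bound `θ < 1/2` ⇒ win bound `2θ`" (`win_le_two_mul_of_rigid`) is vacuous. -/
theorem twoThirds_le_of_rigid_bound (p : ℕ) [Fact p.Prime] (θ : ℝ)
    (h : ∃ n₀ : ℕ, ∀ n ≥ n₀, ∀ k : ℕ, ∀ y : Fin (n + 1) → (Fin n → Bool) → Bool,
      (∀ g, HasDegF p (y g) ((Nat.log 2 n) ^ 0)) →
        ((univ.filter fun u : Fin n → Bool =>
            ringWinU (k + 1) y u = true ∧ ringWinU (k + 2) y u = true).card : ℝ) ≤ θ * (2 : ℝ) ^ n) :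
    2 / 3 ≤ θ := by
  by_contra hθ
  have hθ' : θ < 2 / 3 := not_le.mp hθ
  have hε : 0 < 2 / 3 - θ := by linarith
  obtain ⟨n₀, hn₀⟩ := h
  obtain ⟨N, hN⟩ := exists_nat_gt (1 / (2 / 3 - θ))
  obtain ⟨n, hn₀n, h1n, hNn⟩ : ∃ n, n₀ ≤ n ∧ 1 ≤ n ∧ N ≤ n :=
    ⟨max (max n₀ 1) N, le_trans (le_max_left _ _) (le_max_left _ _),
      le_trans (le_max_right _ _) (le_max_left _ _), le_max_right _ _⟩
  have hpow : (N : ℝ) ≤ (2 : ℝ) ^ n := by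
    have : N ≤ 2 ^ n := le_trans (Nat.lt_two_pow_self (n := N)).le (Nat.pow_le_pow_right (by norm_num) hNn)
    exact_mod_cast this
  have hb := hn₀ n hn₀n n (blind ({0, Fin.last n} : Finset (Fin (n + 1))))
    (fun g => hasDegF_blind p _ g _)
  have hc := rigid_corner_twoThirds (n := n) h1n n rfl
  have key : (2 / 3 - θ) * (2 : ℝ) ^ n ≤ 2 / 3 := by linarith
  have h2 : 1 < (2 / 3 - θ) * N := by
    have := (div_lt_iff₀ hε).1 hN
    linarith
  have h3 : (2 / 3 - θ) * N ≤ (2 / 3 - θ) * (2 : ℝ) ^ n := mul_le_mul_of_nonneg_left hpow hε.le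
  linarith

/-- re-indexing: `WIN_c ∩ WIN_{c+1}` is the rigid set at `c+2` (charges mod 3). -/
theorem filter_win_succ_eq_rigid (c : ℕ) (y : Fin (n + 1) → (Fin n → Bool) → Bool) :
    (univ.filter fun u : Fin n → Bool => ringWinU c y u = true ∧ ringWinU (c + 1) y u = true) =
      univ.filter fun u : Fin n → Bool =>
        ringWinU (c + 2 + 1) y u = true ∧ ringWinU (c + 2 + 2) y u = true :=
  Finset.filter_congr fun u _ => by
    rw [ringWinU_congr_mod (c + 2 + 1) c (by omega), ringWinU_congr_mod (c + 2 + 2) (c + 1) (by omega)]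

/-- re-indexing: `WIN_c ∩ WIN_{c+2}` is the rigid set at `c+1`. -/
theorem filter_win_add_two_eq_rigid (c : ℕ) (y : Fin (n + 1) → (Fin n → Bool) → Bool) :
    (univ.filter fun u : Fin n → Bool => ringWinU c y u = true ∧ ringWinU (c + 2) y u = true) =
      univ.filter fun u : Fin n → Bool =>
        ringWinU (c + 1 + 1) y u = true ∧ ringWinU (c + 1 + 2) y u = true :=
  Finset.filter_congr fun u _ => by
    rw [ringWinU_congr_mod (c + 1 + 1) (c + 2) (by omega), ringWinU_congr_mod (c + 1 + 2) c (by omega),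
      and_comm]

/-- the cheap lift that the corner forbids: a rigidity constant below `1/2` WOULD give the one-charge bound
with constant `2θ` (by `card_win_eq_sum`).  Recorded to show exactly where L needs an idea. -/
theorem win_le_two_mul_of_rigid (θ : ℝ) (c : ℕ) (y : Fin (n + 1) → (Fin n → Bool) → Bool)
    (h : ∀ k : ℕ, ((univ.filter fun u : Fin n → Bool =>
        ringWinU (k + 1) y u = true ∧ ringWinU (k + 2) y u = true).card : ℝ) ≤ θ * (2 : ℝ) ^ n) :
    ((univ.filter fun u : Fin n → Bool => ringWinU c y u = true).card : ℝ) ≤ 2 * θ * (2 : ℝ) ^ n := by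
  have hsum' : ((univ.filter fun u : Fin n → Bool => ringWinU c y u = true).card : ℝ) =
      ((univ.filter fun u : Fin n → Bool => ringWinU c y u = true ∧ ringWinU (c + 1) y u = true).card : ℝ) +
      ((univ.filter fun u : Fin n → Bool => ringWinU c y u = true ∧ ringWinU (c + 2) y u = true).card : ℝ) := by
    exact_mod_cast card_win_eq_sum c y
  have hA := h (c + 2)
  have hB := h (c + 1)
  rw [← filter_win_succ_eq_rigid c y] at hA
  rw [← filter_win_add_two_eq_rigid c y] at hB
  linarith

/-- **forced structure of an extremal counterexample in a W-world**: if `y` wins at `c` on `≥ (1-ε)·2ⁿ`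
inputs while every rigid mass of `y` is `≤ θ·2ⁿ`, then BOTH rigid parts of its win set have mass
`≥ (1-ε-θ)·2ⁿ` — a near-perfect avoider of `-(wt u + c)` computes `-(wt u + c + 1)` and `-(wt u + c + 2)`
each on a `(1-ε-θ)`-fraction (with the admissible `θ ≥ 2/3`: each on `≳ 1/3 - ε`). -/
theorem rigid_parts_of_nearPerfect (θ ε : ℝ) (c : ℕ) (y : Fin (n + 1) → (Fin n → Bool) → Bool)
    (hwin : (1 - ε) * (2 : ℝ) ^ n ≤ ((univ.filter fun u : Fin n → Bool => ringWinU c y u = true).card : ℝ))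
    (h : ∀ k : ℕ, ((univ.filter fun u : Fin n → Bool =>
        ringWinU (k + 1) y u = true ∧ ringWinU (k + 2) y u = true).card : ℝ) ≤ θ * (2 : ℝ) ^ n) :
    (1 - ε - θ) * (2 : ℝ) ^ n ≤ ((univ.filter fun u : Fin n → Bool =>
        ringWinU c y u = true ∧ ringWinU (c + 1) y u = true).card : ℝ) ∧
      (1 - ε - θ) * (2 : ℝ) ^ n ≤ ((univ.filter fun u : Fin n → Bool =>
        ringWinU c y u = true ∧ ringWinU (c + 2) y u = true).card : ℝ) := by
  have hsum' : ((univ.filter fun u : Fin n → Bool => ringWinU c y u = true).card : ℝ) =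
      ((univ.filter fun u : Fin n → Bool => ringWinU c y u = true ∧ ringWinU (c + 1) y u = true).card : ℝ) +
      ((univ.filter fun u : Fin n → Bool => ringWinU c y u = true ∧ ringWinU (c + 2) y u = true).card : ℝ) := by
    exact_mod_cast card_win_eq_sum c y
  have hA := h (c + 2)
  have hB := h (c + 1)
  rw [← filter_win_succ_eq_rigid c y] at hA
  rw [← filter_win_add_two_eq_rigid c y] at hB
  constructor <;> linarith

/-! ## §6 The group law (strategies under XOR) and the coset / Klein-four structure -/

/-- cutwise XOR of two strategies. -/
def xorStrat (y y' : Fin (n + 1) → (Fin n → Bool) → Bool) : Fin (n + 1) → (Fin n → Bool) → Bool :=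
  fun g u => Bool.xor (y g u) (y' g u)

/-- degrees add at most: `[f ⊕ f'] = [f] + [f'] − 2[f][f']`. -/
theorem hasDegF_xor {p : ℕ} [Fact p.Prime] {d d' : ℕ} {f f' : (Fin n → Bool) → Bool}
    (hf : HasDegF p f d) (hf' : HasDegF p f' d') :
    HasDegF p (fun x => Bool.xor (f x) (f' x)) (d + d') := by
  unfold HasDegF at *
  have key : (fun x : Fin n → Bool => if Bool.xor (f x) (f' x) = true then (1 : ZMod p) else 0) =
      (fun x => if f x = true then (1 : ZMod p) else 0) + (fun x => if f' x = true then (1 : ZMod p) else 0) -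
        (2 : ZMod p) • ((fun x => if f x = true then (1 : ZMod p) else 0) *
          (fun x => if f' x = true then (1 : ZMod p) else 0)) := by
    funext x
    simp only [Pi.add_apply, Pi.sub_apply, Pi.smul_apply, Pi.mul_apply, smul_eq_mul]
    cases f x <;> cases f' x <;> norm_num
  rw [key]
  exact Submodule.sub_mem _
    (Submodule.add_mem _ (lowDeg_mono (Nat.le_add_right d d') hf) (lowDeg_mono (Nat.le_add_left d' d) hf'))
    (Submodule.smul_mem _ _ (mul_mem_lowDeg_add hf hf'))

/-- the XOR of two strategies of degrees `d`, `d'` has degree `d + d'`, cutwise. -/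
theorem hasDegF_xorStrat {p : ℕ} [Fact p.Prime] {d d' : ℕ} {y y' : Fin (n + 1) → (Fin n → Bool) → Bool}
    (hy : ∀ g, HasDegF p (y g) d) (hy' : ∀ g, HasDegF p (y' g) d') (g : Fin (n + 1)) :
    HasDegF p (xorStrat y y' g) (d + d') :=
  hasDegF_xor (hy g) (hy' g)

/-- **character law**: `WIN_c(y ⊕ y') = WIN_c(y) ⊕ WIN_c(y')` pointwise (the live fired set of `y ⊕ y'` is
the symmetric difference of the two live fired sets). -/
theorem ringWinU_xorStrat (c : ℕ) (y y' : Fin (n + 1) → (Fin n → Bool) → Bool) (u : Fin n → Bool) :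
    ringWinU c (xorStrat y y') u = Bool.xor (ringWinU c y u) (ringWinU c y' u) := by
  unfold ringWinU
  symm
  apply Coset21.xor_decide_of_sum
    (F := (univ.filter fun g : Fin (n + 1) =>
        xorStrat y y' g u = true ∧ (c + g.val + walkExp u g.val) % 3 ≠ 0).card +
      (univ.filter fun g : Fin (n + 1) =>
        (y g u = true ∧ y' g u = true) ∧ (c + g.val + walkExp u g.val) % 3 ≠ 0).card)
  have key : ∀ g : Fin (n + 1),
      (if y g u = true ∧ (c + g.val + walkExp u g.val) % 3 ≠ 0 then 1 else 0) +
        (if y' g u = true ∧ (c + g.val + walkExp u g.val) % 3 ≠ 0 then 1 else 0) +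
        (if xorStrat y y' g u = true ∧ (c + g.val + walkExp u g.val) % 3 ≠ 0 then 1 else 0) =
      2 * ((if xorStrat y y' g u = true ∧ (c + g.val + walkExp u g.val) % 3 ≠ 0 then 1 else 0) +
        (if (y g u = true ∧ y' g u = true) ∧ (c + g.val + walkExp u g.val) % 3 ≠ 0 then 1 else 0)) := by
    intro g
    unfold xorStrat
    by_cases hL : (c + g.val + walkExp u g.val) % 3 ≠ 0 <;> cases y g u <;> cases y' g u <;> simp [hL]
  simp only [Finset.card_filter]
  rw [← Finset.sum_add_distrib, ← Finset.sum_add_distrib, ← Finset.sum_add_distrib, Finset.mul_sum]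
  exact Finset.sum_congr rfl fun g _ => key g

/-- `u` is won by `y ⊕ y'` iff exactly one of `y`, `y'` wins it. -/
theorem win_xorStrat_iff (c : ℕ) (y y' : Fin (n + 1) → (Fin n → Bool) → Bool) (u : Fin n → Bool) :
    ringWinU c (xorStrat y y') u = true ↔ ringWinU c y u ≠ ringWinU c y' u := by
  rw [ringWinU_xorStrat]
  cases ringWinU c y u <;> cases ringWinU c y' u <;> simp

/-- COSET law: near-perfect ⊕ near-perfect is near-null (`#WIN(y ⊕ y') ≤ #LOSE(y) + #LOSE(y')`). -/
theorem card_win_xorStrat_le (c : ℕ) (y y' : Fin (n + 1) → (Fin n → Bool) → Bool) :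
    (univ.filter fun u : Fin n → Bool => ringWinU c (xorStrat y y') u = true).card ≤
      (univ.filter fun u : Fin n → Bool => ringWinU c y u = false).card +
        (univ.filter fun u : Fin n → Bool => ringWinU c y' u = false).card := by
  calc (univ.filter fun u : Fin n → Bool => ringWinU c (xorStrat y y') u = true).card
      ≤ ((univ.filter fun u : Fin n → Bool => ringWinU c y u = false) ∪
          (univ.filter fun u : Fin n → Bool => ringWinU c y' u = false)).card := by
        apply Finset.card_le_card
        intro u hu
        simp only [Finset.mem_filter, Finset.mem_univ, true_and, Finset.mem_union] at hu ⊢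
        rw [win_xorStrat_iff] at hu
        revert hu
        cases ringWinU c y u <;> cases ringWinU c y' u <;> simp
    _ ≤ _ := Finset.card_union_le _ _


end Summit.QuantumAdvantage.AdviceFreeQNC0.RigidityLaws
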